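import Summits.QuantumFields.YangMills.Theorems.BalabanUVNodesN15NeumannCubeTailRowDefect
import Summits.QuantumFields.YangMills.Theorems.BalabanUVNodesN15VectorPieceBackgroundMatrix
import HarnessLib

/-!
# Route «BalabanUVNodes» (K3⁸ `SpineGivenEndpointR13SepCoPHV`, stmt-QuantumFields-27366), node N15 = NE2, -a lane, PROGRAMME N file N-IIv: THE TAIL ROWS `⊗ 1_ι` — N-IIt ∕ N-IIu read on
# the COLOURED carrier `X × ι` of dag-n15-w3's files 44∕45 (`liftBlk`, `tensorId`): `(−M_{h∘fst}∘(N_L ⊗ 1)∘M_{ψ∘fst})∘(G(□+c) ⊗ 1) ≤ 1_□1_□·ε₀e^{−ρd}` at both spacings and its η-defect, with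
# the componentwise-lift dictionary (`M_{f∘fst}∘(T ⊗ 1) = (M_f∘T) ⊗ 1`)

Cell `pub-ymgap`, seat `pub-ymgap-dag-n15-a` (KNIT-BY-NAME, g23; HUMAN RULING D-0062; chair R424 venue; `bears_on: R4∕N15`).  Filed `--kind proof --supports stmt-QuantumFields-27366
--as helper` — COUNT-NEUTRAL.  Theorems only (0 `def`, 0 `sorry`).  Imports BY NAME N-IIu `…NeumannCubeTailRowDefect` (N-IIt `hasMaj_tail_neumannCubeG`, N-IIu `hasMaj_idef_tail_neumannCubeG_of`)
and dag-n15-c's `…VectorPieceBackgroundMatrix` (`tensorId`, `hasMaj_tensorId`, `idef_tensorId`); nothing in the tree is modified.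

WHY.  Files 44∕45 (and n15-w3 g5's gauged ∕ `U(m)` capstones) state the tail rows `hT ∕ hT′ ∕ hDT` on the product carrier `X × ι` (colour index `ι`, blocks `liftBlk blk ι`), with the flat
cube operator `N_k` and the flat nonlocal part `N_L` acting componentwise.  N-IIt∕N-IIu typed the rows for this lane's colourless Neumann cubes; THIS FILE is their componentwise lift:
`N_k := G(□+c) ⊗ 1_ι = tensorId ι (neumannCubeG …)`, `N_L ⊗ 1_ι`, multipliers `h∘fst`, `ψ∘fst` — the exact letter shapes of the consumers, no new estimate.

* §1 dictionary: `tensorId_mulOp` (`M_f ⊗ 1 = M_{f∘fst}`), `mulOp_fst_comp_tensorId`, `tensorId_comp_mulOp_fst`, ★ `tail_tensorId_eq` (`(−M_{h∘fst}(N_L ⊗ 1)M_{ψ∘fst})(N ⊗ 1) = ((−M_hN_LM_ψ)N) ⊗ 1`);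
* §2 ★★★ `hasMaj_tail_tensorId_neumannCubeG` (`hT`∕`hT′` shape, any spacing, letters displayed as in N-IIt §3), ★★★ `hasMaj_idef_tail_tensorId_neumannCubeG_of` (`hDT` shape, N-IIu §2's letters).

HONEST FRAMING ∕ LIMITS.  Operator identities + `hasMaj_tensorId` ∕ `idef_tensorId` over LANDED rows; `U ≡ 1` doubled-cube torus MODEL (one-cube model); nothing of [B5]∕[B6]∕[B9] asserted;
NE2⁺ NOT PRINTED ∕ NOT proved; N15 NOT discharged; K3⁸ OPEN, skeleton v6 untouched; counts of record UNMOVED (typed 28∕28 · discharged 5∕27); one finite 𝕋⁴ at fixed ε — NOT infinite volume,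
NOT OS on ℝ⁴, NOT a mass gap, NOT Clay.
-/

noncomputable section

namespace Summit.QuantumFields.YangMills.BalabanUVNodes.N15.TwoGrid

open Literature.MathematicalPhysics.QuantumFieldTheory.Balaban1983to89
open Literature.MathematicalPhysics.QuantumFieldTheory.Balaban1983to89.B5Prop11Plancherel (Tor fine)
open Literature.MathematicalPhysics.QuantumFieldTheory.Balaban1983to89.B6Prop26Gluing (mulOp mulOp_apply ind ind_nonneg)
open Literature.MathematicalPhysics.QuantumFieldTheory.King1986.Torus (blockOf tdistT)
open Literature.MathematicalPhysics.QuantumFieldTheory.Balaban1983to89.B11SectG (BlockNorm HasMaj RowSum)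
open Literature.MathematicalPhysics.QuantumFieldTheory.Balaban1983to89.B6UnitTorusCarrier (unitTorusGeo)
open Literature.MathematicalPhysics.QuantumFieldTheory.Balaban1983to89.B6RandomWalk (Triangle254)
open Literature.MathematicalPhysics.QuantumFieldTheory.Balaban1983to89.T4EtaRateDefect (idef)
open Literature.MathematicalPhysics.QuantumFieldTheory.Balaban1983to89.T4EtaRateCoeffDefect (pull)
open Summit.QuantumFields.YangMills.BalabanUVNodes.N15.MatrixSpecies (liftMap liftBlk)
open Summit.QuantumFields.YangMills.BalabanUVNodes.N15.VectorPiece (kingPrV tensorId tensorId_apply hasMaj_tensorId idef_tensorId)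

variable {d : ℕ}

/-! ## §1 The componentwise-lift dictionary for multipliers -/

section Dictionary

variable {X X₂ : Type} (ι : Type)

/-- `M_f ⊗ 1_ι = M_{f∘fst}`. [folklore] -/
theorem tensorId_mulOp (f : X → ℝ) : tensorId ι (mulOp f) = mulOp (fun p : X × ι => f p.1) :=
  LinearMap.ext fun _ => funext fun _ => rfl

/-- `M_{f∘fst} ∘ (T ⊗ 1) = (M_f ∘ T) ⊗ 1`. [folklore] -/
theorem mulOp_fst_comp_tensorId (f : X₂ → ℝ) (T : (X → ℝ) →ₗ[ℝ] (X₂ → ℝ)) :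
    mulOp (fun p : X₂ × ι => f p.1) ∘ₗ tensorId ι T = tensorId ι (mulOp f ∘ₗ T) :=
  LinearMap.ext fun _ => funext fun _ => rfl

/-- `(T ⊗ 1) ∘ M_{f∘fst} = (T ∘ M_f) ⊗ 1`. [folklore] -/
theorem tensorId_comp_mulOp_fst (f : X → ℝ) (T : (X → ℝ) →ₗ[ℝ] (X₂ → ℝ)) :
    tensorId ι T ∘ₗ mulOp (fun p : X × ι => f p.1) = tensorId ι (T ∘ₗ mulOp f) :=
  LinearMap.ext fun _ => funext fun _ => rfl

/-- ★ the tail operator's lift: `(−(M_{h∘fst} ∘ (N_L ⊗ 1) ∘ M_{ψ∘fst})) ∘ (N ⊗ 1) = ((−(M_h ∘ N_L ∘ M_ψ)) ∘ N) ⊗ 1`. [folklore] -/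
theorem tail_tensorId_eq (h ψ : X → ℝ) (NL N : (X → ℝ) →ₗ[ℝ] (X → ℝ)) :
    (-(mulOp (fun p : X × ι => h p.1) ∘ₗ tensorId ι NL ∘ₗ mulOp (fun p : X × ι => ψ p.1))) ∘ₗ tensorId ι N = tensorId ι ((-(mulOp h ∘ₗ NL ∘ₗ mulOp ψ)) ∘ₗ N) :=
  LinearMap.ext fun _ => funext fun _ => rfl

end Dictionary

/-! ## §2 The tail rows and their η-defect on the coloured carrier -/

section Rows

variable {L : ℕ} {M : Fin (d + 1) → ℕ} [∀ μ, NeZero (M μ)] {k n r : ℕ} [NeZero n] {c : Tor M} {S : ℕ} {ι : Type} [Fintype ι]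

/-- ★★★ **THE TAIL ROW ON THE COLOURED CARRIER** (files 44∕45 `hT`, and `hT′` at the fine spacing; N-IIt `hasMaj_tail_neumannCubeG` lifted by `hasMaj_tensorId`): same letters, same constant.
[cite: Balaban1984PropagatorsII, (2.36)–(2.37) p.229, (2.92)–(2.93) p.239, (2.133)–(2.134) p.247, (2.156) p.250 (the `U ≡ 1` propagator on `𝔤`-valued forms: shape); Balaban1984PropagatorsI, (1.120)–(1.123) p.37, (1.126) p.38] -/
theorem hasMaj_tail_tensorId_neumannCubeG (hM : ∀ ν, M ν = 2 * S) {a C δ₀ C₁ δ₁ δN ρ₁ ρ σ cr gap : ℝ}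
    (htri : Triangle254 (unitTorusGeo L k M)) (hrow : RowSum (unitTorusGeo L k M) σ cr) (hC : 0 ≤ C) (hδ₀ : 0 ≤ δ₀) (hC₁ : 0 ≤ C₁) (hδN : 0 ≤ δN) (hδN₁ : δN ≤ δ₁)
    (hρ₁ : ρ₁ ≤ δN) (hρ : 0 ≤ ρ) (hρδ : ρ ≤ δ₀) (hρσ : ρ + σ ≤ ρ₁)
    (hG : HasMaj (BlockNorm.ofBlocks (unitTorusGeo L k M) (fun b : Tor (fine n M) × Fin (d + 1) => blockOf n M b.1))
      (BlockNorm.ofBlocks (unitTorusGeo L k M) (fun b : Tor (fine n M) × Fin (d + 1) => blockOf n M b.1)) (gOp M n a) (fun y y' => C * Real.exp (-(δ₀ * tdistT M y y'))))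
    (hNL : HasMaj (BlockNorm.ofBlocks (unitTorusGeo L k M) (fun b : Tor (fine n M) × Fin (d + 1) => blockOf n M b.1))
      (BlockNorm.ofBlocks (unitTorusGeo L k M) (fun b : Tor (fine n M) × Fin (d + 1) => blockOf n M b.1)) (landauRe M n) (fun y y' => C₁ * Real.exp (-(δ₁ * tdistT M y y'))))
    {h ψ : Tor (fine n M) × Fin (d + 1) → ℝ} {H A : Set (Tor M)}
    (hh1 : ∀ x, |h x| ≤ 1) (hhH : ∀ x, blockOf n M x.1 ∉ H → h x = 0) (hHc : ∀ y, y ∈ H → y ∈ cubeBlocks M c S)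
    (hψ1 : ∀ x, |ψ x| ≤ 1) (hψA : ∀ x, blockOf n M x.1 ∈ A → ψ x = 0) (hgap : ∀ y y', y ∈ H → y' ∉ A → gap ≤ tdistT M y y') :
    HasMaj (BlockNorm.ofBlocks (unitTorusGeo L k M) (liftBlk (fun b : Tor (fine n M) × Fin (d + 1) => blockOf n M b.1) ι))
      (BlockNorm.ofBlocks (unitTorusGeo L k M) (liftBlk (fun b : Tor (fine n M) × Fin (d + 1) => blockOf n M b.1) ι))
      ((-(mulOp (fun p : (Tor (fine n M) × Fin (d + 1)) × ι => h p.1) ∘ₗ tensorId ι (a • (qvAdjRe M n ∘ₗ qvRe M n) + (-landauRe M n)) ∘ₗ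
          mulOp (fun p : (Tor (fine n M) × Fin (d + 1)) × ι => ψ p.1))) ∘ₗ tensorId ι (neumannCubeG M n c S a))
      (fun y y' => ind (cubeBlocks M c S : Set (Tor M)) y * ind (cubeBlocks M c S : Set (Tor M)) y' *
        (2 ^ (d + 1) * ((|a| * (Real.exp δN * Real.exp δN) + C₁) * Real.exp (-((δN - ρ₁) * gap)) * (C * Real.exp δ₀) * cr) * Real.exp (-(ρ * tdistT M y y')))) := by
  have hcr : 0 ≤ cr := hrow.nonneg c
  rw [tail_tensorId_eq]
  exact hasMaj_tensorId ι (fun y y' => mul_nonneg (mul_nonneg (ind_nonneg _ _) (ind_nonneg _ _)) (by positivity))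
    (hasMaj_tail_neumannCubeG (L := L) (k := k) (c := c) (S := S) hM htri hrow hC hδ₀ hC₁ hδN hδN₁ hρ₁ hρ hρδ hρσ hG hNL hh1 hhH hHc hψ1 hψA hgap)

/-- ★★★ **THE η-DEFECT OF THE TAIL ROW ON THE COLOURED CARRIER** (file 45 `hDT`; N-IIu `hasMaj_idef_tail_neumannCubeG_of` lifted by `idef_tensorId` + `hasMaj_tensorId`): coarse `n = L^k`,
fine `n′ = L^r·n`, the pairing lifted as `liftMap (kingPrV …) ι`; same letters, same constant.
[cite: Balaban1985BackgroundPropagators, Thm 3.14 pp.426–427 (difference template); Balaban1984PropagatorsII, (2.36)–(2.37) p.229, (2.92)–(2.93) p.239, (2.133)–(2.134) p.247, (2.156) p.250; Balaban1984PropagatorsI, (1.69) p.29, Prop. 1.2 (1.110) p.35, (1.120)–(1.123) p.37, (1.126)–(1.128) p.38] -/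
theorem hasMaj_idef_tail_tensorId_neumannCubeG_of [NeZero L] (hM : ∀ ν, M ν = 2 * S) {a : ℝ} (ha : 0 < a) {C C₀ CD δ₀ C₁ δ₁ δN rN ρ₁ ρ σ cr gap oh oψ : ℝ}
    (htri : Triangle254 (unitTorusGeo L k M)) (hrow : RowSum (unitTorusGeo L k M) σ cr) (hC : 0 ≤ C) (hC₀ : 0 ≤ C₀) (hCD : 0 ≤ CD) (hδ₀ : 0 ≤ δ₀) (hC₁ : 0 ≤ C₁) (hδN : 0 ≤ δN)
    (hδN₁ : δN ≤ δ₁) (hrN : 0 ≤ rN) (hρ₁ : ρ₁ ≤ δN) (hρ : 0 ≤ ρ) (hρδ : ρ ≤ δ₀) (hρσ : ρ + σ ≤ ρ₁) (hoh : 0 ≤ oh) (hoψ : 0 ≤ oψ)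
    (hG : HasMaj (BlockNorm.ofBlocks (unitTorusGeo L k M) (fun b : Tor (fine (L ^ k) M) × Fin (d + 1) => blockOf (L ^ k) M b.1))
      (BlockNorm.ofBlocks (unitTorusGeo L k M) (fun b : Tor (fine (L ^ k) M) × Fin (d + 1) => blockOf (L ^ k) M b.1)) (gOp M (L ^ k) a)
      (fun y y' => C * Real.exp (-(δ₀ * tdistT M y y'))))
    (h0 : HasMaj (BlockNorm.ofBlocks (unitTorusGeo L k M) (fun b : Tor (fine (L ^ k) M) × Fin (d + 1) => blockOf (L ^ k) M b.1))
      (BlockNorm.ofBlocks (unitTorusGeo L k M) (fun b' : Tor (fine (L ^ r * L ^ k) M) × Fin (d + 1) => blockOf (L ^ r * L ^ k) M b'.1))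
      (idef (pull (kingPrV L k r M)) (pull (kingPrV L k r M)) (gOp M (L ^ r * L ^ k) a) (gOp M (L ^ k) a)) (fun y y' => C₀ * Real.exp (-(δ₀ * tdistT M y y'))))
    (h1 : ∀ ν, HasMaj (BlockNorm.ofBlocks (unitTorusGeo L k M) (fun b : Tor (fine (L ^ k) M) × Fin (d + 1) => blockOf (L ^ k) M b.1))
      (BlockNorm.ofBlocks (unitTorusGeo L k M) (fun b : Tor (fine (L ^ k) M) × Fin (d + 1) => blockOf (L ^ k) M b.1))
      (symbOp M (L ^ k) (sD M (L ^ k) ν ((L ^ k : ℕ) : ℝ)) ∘ₗ gOp M (L ^ k) a) (fun y y' => CD * Real.exp (-(δ₀ * tdistT M y y'))))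
    (hNL : HasMaj (BlockNorm.ofBlocks (unitTorusGeo L k M) (fun b : Tor (fine (L ^ k) M) × Fin (d + 1) => blockOf (L ^ k) M b.1))
      (BlockNorm.ofBlocks (unitTorusGeo L k M) (fun b : Tor (fine (L ^ k) M) × Fin (d + 1) => blockOf (L ^ k) M b.1)) (landauRe M (L ^ k))
      (fun y y' => C₁ * Real.exp (-(δ₁ * tdistT M y y'))))
    (hNL' : HasMaj (BlockNorm.ofBlocks (unitTorusGeo L k M) (fun b : Tor (fine (L ^ r * L ^ k) M) × Fin (d + 1) => blockOf (L ^ r * L ^ k) M b.1))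
      (BlockNorm.ofBlocks (unitTorusGeo L k M) (fun b : Tor (fine (L ^ r * L ^ k) M) × Fin (d + 1) => blockOf (L ^ r * L ^ k) M b.1)) (landauRe M (L ^ r * L ^ k))
      (fun y y' => C₁ * Real.exp (-(δ₁ * tdistT M y y'))))
    (hDN : HasMaj (BlockNorm.ofBlocks (unitTorusGeo L k M) (fun b : Tor (fine (L ^ k) M) × Fin (d + 1) => blockOf (L ^ k) M b.1))
      (BlockNorm.ofBlocks (unitTorusGeo L k M) (fun b : Tor (fine (L ^ r * L ^ k) M) × Fin (d + 1) => blockOf (L ^ r * L ^ k) M b.1))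
      (idef (pull (kingPrV L k r M)) (pull (kingPrV L k r M)) (a • (qvAdjRe M (L ^ r * L ^ k) ∘ₗ qvRe M (L ^ r * L ^ k)) + (-landauRe M (L ^ r * L ^ k)))
        (a • (qvAdjRe M (L ^ k) ∘ₗ qvRe M (L ^ k)) + (-landauRe M (L ^ k)))) (fun y y' => rN * Real.exp (-(δN * tdistT M y y'))))
    {h ψ : Tor (fine (L ^ k) M) × Fin (d + 1) → ℝ} {h' ψ' : Tor (fine (L ^ r * L ^ k) M) × Fin (d + 1) → ℝ} {H A : Set (Tor M)}
    (hhH : ∀ x, blockOf (L ^ k) M x.1 ∉ H → h x = 0) (hHc : ∀ y, y ∈ H → y ∈ cubeBlocks M c S)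
    (hψ1 : ∀ x, |ψ x| ≤ 1) (hψA : ∀ x, blockOf (L ^ k) M x.1 ∈ A → ψ x = 0)
    (hh1' : ∀ x', |h' x'| ≤ 1) (hhH' : ∀ x', blockOf (L ^ r * L ^ k) M x'.1 ∉ H → h' x' = 0)
    (hψ1' : ∀ x', |ψ' x'| ≤ 1) (hψA' : ∀ x', blockOf (L ^ r * L ^ k) M x'.1 ∈ A → ψ' x' = 0)
    (hfh : ∀ x', |h' x' - h (kingPrV L k r M x')| ≤ oh) (hfψ : ∀ x', |ψ' x' - ψ (kingPrV L k r M x')| ≤ oψ)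
    (hgap : ∀ y y', y ∈ H → y' ∉ A → gap ≤ tdistT M y y') :
    HasMaj (BlockNorm.ofBlocks (unitTorusGeo L k M) (liftBlk (fun b : Tor (fine (L ^ k) M) × Fin (d + 1) => blockOf (L ^ k) M b.1) ι))
      (BlockNorm.ofBlocks (unitTorusGeo L k M) (liftBlk (fun b' : Tor (fine (L ^ r * L ^ k) M) × Fin (d + 1) => blockOf (L ^ r * L ^ k) M b'.1) ι))
      (idef (pull (liftMap (kingPrV L k r M) ι)) (pull (liftMap (kingPrV L k r M) ι))
        ((-(mulOp (fun p : (Tor (fine (L ^ r * L ^ k) M) × Fin (d + 1)) × ι => h' p.1) ∘ₗ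
            tensorId ι (a • (qvAdjRe M (L ^ r * L ^ k) ∘ₗ qvRe M (L ^ r * L ^ k)) + (-landauRe M (L ^ r * L ^ k))) ∘ₗ
            mulOp (fun p : (Tor (fine (L ^ r * L ^ k) M) × Fin (d + 1)) × ι => ψ' p.1))) ∘ₗ tensorId ι (neumannCubeG M (L ^ r * L ^ k) c S a))
        ((-(mulOp (fun p : (Tor (fine (L ^ k) M) × Fin (d + 1)) × ι => h p.1) ∘ₗ tensorId ι (a • (qvAdjRe M (L ^ k) ∘ₗ qvRe M (L ^ k)) + (-landauRe M (L ^ k))) ∘ₗ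
            mulOp (fun p : (Tor (fine (L ^ k) M) × Fin (d + 1)) × ι => ψ p.1))) ∘ₗ tensorId ι (neumannCubeG M (L ^ k) c S a)))
      (fun y y' => ind (cubeBlocks M c S : Set (Tor M)) y * ind (cubeBlocks M c S : Set (Tor M)) y' *
        ((2 ^ (d + 1) * Real.exp δ₀ * cr *
          ((|a| * (Real.exp δN * Real.exp δN) + C₁) * Real.exp (-((δN - ρ₁) * gap)) * C₀ +
            (|a| * (Real.exp δN * Real.exp δN) + C₁) * Real.exp (-((δN - ρ₁) * gap)) * ((d + 1) * (CD / (L ^ k : ℕ))) +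
            ((|a| * (Real.exp δN * Real.exp δN) + C₁) * oψ + rN + oh * (|a| * (Real.exp δN * Real.exp δN) + C₁)) * Real.exp (-((δN - ρ₁) * gap)) * C)) *
          Real.exp (-(ρ * tdistT M y y')))) := by
  have hcr : 0 ≤ cr := hrow.nonneg c
  rw [tail_tensorId_eq, tail_tensorId_eq, idef_tensorId]
  exact hasMaj_tensorId ι (fun y y' => mul_nonneg (mul_nonneg (ind_nonneg _ _) (ind_nonneg _ _)) (by positivity))
    (hasMaj_idef_tail_neumannCubeG_of (L := L) (k := k) (r := r) (c := c) (S := S) hM ha htri hrow hC hC₀ hCD hδ₀ hC₁ hδN hδN₁ hrN hρ₁ hρ hρδ hρσ hoh hoψ hG h0 h1 hNL hNL' hDN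
      hhH hHc hψ1 hψA hh1' hhH' hψ1' hψA' hfh hfψ hgap)

end Rows

end Summit.QuantumFields.YangMills.BalabanUVNodes.N15.TwoGrid

end
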